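import Literature.AlgebraicGeometry.AbelianSchemes.AbelianSchemeOverMulNEtale
import Literature.AlgebraicGeometry.Modules.PushforwardUnitHasRankOfFinrank
import HarnessLib

/-!
# `[N]_X` and `X[N] → S` are finite locally free of RANK `N^{2g}`: `HasRank (f_* 𝒪) (N^{2g})`

Topic `AlgebraicGeometry/AbelianSchemes`; namespace `Literature.AlgebraicGeometry.AbelianSchemes.AbelianSchemeOver`.  THEOREMS
ONLY (no definition, no named fact, no instance, no `sorry`).

[GortzWedhorn2023] Prop. 27.186 (p. 674): `deg [n]_X = n^{2g}`; Prop. 27.188 (1) (p. 675): «`X[n]` is finite étale over `S`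
of degree `n^{2g}`».  [MumfordFogartyKirwan1994] Ch. 7 §3, proof of Lemma 7.11 (p. 140): «locally free … its rank is
`k^{2g}`».  In the tree these ranks are ★ in Mathlib's POINTWISE `Scheme.Hom.finrank` currency
(★ `AbelianSchemeOverMulNEtale.finrank_pow_id_left`, `finrank_fst_unit_pow_id`); with the dictionary ★
`Modules.hasRank_pushforward_unit_of_finrank_eq` (`Modules/PushforwardUnitHasRankOfFinrank`) they become the literal
«finite locally free of degree `N^{2g}`» statements of the cell's F-DAG price sheet, row F-1 (c): the direct image of the
structure sheaf is locally free of constant rank `N^{2g}` (the tree's `Motives.HasRank`), over a locally noetherian base.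

* `hasRank_pushforward_unit_pow_id_left` — `HasRank (([N]_X)_* 𝒪_X) (N^{2g})`;
* `hasRank_pushforward_unit_fst_unit_pow_id` — `HasRank ((X[N] → S)_* 𝒪_{X[N]}) (N^{2g})`.

Cell `hodgecm-mathlib` (D-0151); COUNT-NEUTRAL capital (price sheet F-1 (c), feeds F-6/F-10).  HC_CM is proved only
modulo the 7 printed citations until rung 0 closes; this file discharges none of them.

## References
* [GortzWedhorn2023] U. Görtz, T. Wedhorn, *Algebraic Geometry II* (2023), Prop. 27.186 (p. 674), Prop. 27.188 (1) (p. 675).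
* [MumfordFogartyKirwan1994] D. Mumford, J. Fogarty, F. Kirwan, *Geometric Invariant Theory*, 3rd ed. (1994), Ch. 7 §3
  Lemma 7.11 (p. 140).
-/

set_option autoImplicit false

noncomputable section

universe u

open CategoryTheory CategoryTheory.Limits AlgebraicGeometry MonoidalCategory
open Literature.AlgebraicGeometry.Motives

namespace Literature.AlgebraicGeometry.AbelianSchemes

namespace AbelianSchemeOver

open scoped MonObj

variable {S : Scheme.{u}} (A : AbelianSchemeOver S)

/-- **`[N]_X : X → X` is finite locally free of rank `N^{2g}`** — `([N]_X)_* 𝒪_X` is locally free of constant rank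
`N^{2g}` — for `X/S` of relative dimension `g` over a locally noetherian base with `(N : κ(s)) ≠ 0` for all `s`
(★ `finrank_pow_id_left` through the dictionary ★ `Modules.hasRank_pushforward_unit_of_finrank_eq`; `X` is locally
noetherian, being smooth over `S`). [cite: GortzWedhorn2023, Prop. 27.186 (p. 674)] [cite: MumfordFogartyKirwan1994, Ch. 7 §3 Lemma 7.11 (p. 140)] -/
theorem hasRank_pushforward_unit_pow_id_left {g N : ℕ} (hg : A.IsOfRelDim g) (hN : ∀ s : S, (N : S.residueField s) ≠ 0)
    [IsLocallyNoetherian S] :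
    HasRank ((Scheme.Modules.pushforward ((((𝟙 A.X : A.X ⟶ A.X) ^ N) : A.X ⟶ A.X).left)).obj (SheafOfModules.unit _))
      (N ^ (2 * g)) := by
  haveI := A.flat_pow_id_left hN
  haveI := A.isFinite_pow_id_left hN
  haveI : Smooth A.X.hom := A.isSmooth
  haveI : IsLocallyNoetherian A.X.left := LocallyOfFiniteType.isLocallyNoetherian A.X.hom
  exact Modules.hasRank_pushforward_unit_of_finrank_eq _ _ (A.finrank_pow_id_left hg hN)

/-- **`X[N] → S` is finite locally free of rank `N^{2g}`** — `(X[N] → S)_* 𝒪_{X[N]}` is locally free of constant rank `N^{2g}`,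
`X[N] = S ×_{e, X, [N]} X` — under the same hypotheses (★ `finrank_fst_unit_pow_id` through the dictionary).
[cite: GortzWedhorn2023, Prop. 27.188 (1) (p. 675)] [cite: MumfordFogartyKirwan1994, Ch. 7 §3 Lemma 7.11 (p. 140)] -/
theorem hasRank_pushforward_unit_fst_unit_pow_id {g N : ℕ} (hg : A.IsOfRelDim g) (hN : ∀ s : S, (N : S.residueField s) ≠ 0)
    [IsLocallyNoetherian S] :
    haveI := A.flat_pow_id_left hN
    haveI := A.isFinite_pow_id_left hN
    HasRank ((Scheme.Modules.pushforward
      (pullback.fst (η[A.X] : 𝟙_ (Over S) ⟶ A.X).left ((((𝟙 A.X : A.X ⟶ A.X) ^ N) : A.X ⟶ A.X).left))).obj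
        (SheafOfModules.unit _)) (N ^ (2 * g)) := by
  haveI := A.flat_pow_id_left hN
  haveI := A.isFinite_pow_id_left hN
  haveI : IsLocallyNoetherian (𝟙_ (Over S)).left := ‹IsLocallyNoetherian S›
  exact Modules.hasRank_pushforward_unit_of_finrank_eq _ _ (A.finrank_fst_unit_pow_id hg hN)

end AbelianSchemeOver

end Literature.AlgebraicGeometry.AbelianSchemes

end
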